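import Summits.CriticalPhenomena.LaceExpansionHighD.WeightSplitChain
import HarnessLib

/-!
# The diagram-level weight split "LEMMA J", layer B2.5: the three-block chain with ABSTRACT end blocks — cell pub-lace7, Lean seat 3

PROGRAMME-INTERNAL (no printed counterpart; NOT CITABLE as literature).  Companion of `WeightSplitChain` (B2, `chain3_weightSplit_le`:
end blocks = triangles with exchangeable even legs).  Here the left and right blocks are ARBITRARY non-negative finitely supported weights
`L`, `R` on the backbone legs, assumed only to have the conditional drifts `Σ' w_i L(w) = −(r₀)_i/2 · Σ' L` and
`Σ' c_i R(c) = (r₀+s)_i/2 · Σ' R` — which covers, besides the exchangeable-leg triangles (`tsum_coord_mul_shift_eq`), the DEGENERATE end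
blocks of [FvdH17]-ext l.9880–9897 (cases `a = 0` / `b = 0`: an EVEN block such as the double connection `δ_{u,w}·P(0 ⇔ w)` at a vanishing
rung has drift `0 = −r₀/2`).  The square is the generic one (pivotal bond `κ` on `E`, equal even rails `g`).  Statement and proof are those
of `chain3_weightSplit_le` with the two block drifts as hypotheses (`chain3_weightSplit_le_of_drifts`).

HONEST FRAMING: elementary; no percolation object; nothing about any dimension; the boundary cases (ii)/(iii) of LEMMA-J Thm 3
(τ_{≥1} rails, kernel (K′)) are NOT covered.
-/

noncomputable section

namespace Summit.CriticalPhenomena.LaceExpansionHighD.WeightSplit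

open Finset
open scoped BigOperators

variable {d : ℕ}

/-! ### B2.5 The same with ABSTRACT end blocks given by their drifts (covers degenerate / collapsed end blocks) -/

/-- **Three-block chain with abstract end blocks.**  As `chain3_weightSplit_le`, but the left and right blocks are arbitrary
non-negative finitely supported weights `L`, `R` on the backbone legs `w`, `c`, assumed only to have the conditional drifts
`Σ' w_i L(w) = −(r₀)_i/2 · Σ' L` and `Σ' c_i R(c) = (r₀+s)_i/2 · Σ' R` (exchangeable-leg triangles by `tsum_coord_mul_shift_eq`; an EVEN
block at a vanishing rung, e.g. the double connection of the case `a = 0` / `b = 0`, has drift `0`); the square is the generic one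
(bond `κ` on `E`, equal even rails `g`).  Conclusion: `Σ_e κ_e Σ' ‖w+b+c‖² L Q_e R ≤ Σ_e κ_e Σ' (‖w‖²+‖b‖²+‖c‖²) L Q_e R`. -/
theorem chain3_weightSplit_le_of_drifts (E : Finset (Fin d → ℤ)) (hE : ∀ e ∈ E, ∑ i, ((e i : ℤ) : ℝ) ^ 2 ≤ 1)
    (κ : (Fin d → ℤ) → ℝ) (hκ : ∀ e ∈ E, 0 ≤ κ e)
    (L R g : (Fin d → ℤ) → ℝ) (hL0 : ∀ x, 0 ≤ L x) (hR0 : ∀ x, 0 ≤ R x) (hg0 : ∀ x, 0 ≤ g x) (hge : Function.Even g)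
    (SL Sg SR : Finset (Fin d → ℤ)) (hLs : ∀ x ∉ SL, L x = 0) (hSg : ∀ x ∉ Sg, g x = 0) (hRs : ∀ x ∉ SR, R x = 0)
    (r₀ s : Fin d → ℤ)
    (hML : ∀ i, ∑' w, (w i : ℝ) * L w = -((r₀ i : ℝ) / 2) * ∑' w, L w)
    (hMR : ∀ i, ∑' c, (c i : ℝ) * R c = (((r₀ i : ℝ) + (s i : ℝ)) / 2) * ∑' c, R c) :
    ∑ e ∈ E, κ e * ∑' w, ∑' b, ∑' c, (∑ i, ((w i : ℝ) + (b i : ℝ) + (c i : ℝ)) ^ 2)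
        * (L w * (g (b + (s - e)) * g b) * R c)
      ≤ ∑ e ∈ E, κ e * ∑' w, ∑' b, ∑' c, (∑ i, ((w i : ℝ)) ^ 2 + ∑ i, ((b i : ℝ)) ^ 2 + ∑ i, ((c i : ℝ)) ^ 2)
        * (L w * (g (b + (s - e)) * g b) * R c) := by
  -- supports of the three block weights
  have hQs : ∀ e : Fin d → ℤ, ∀ x ∉ Sg, g (x + (s - e)) * g x = 0 := fun e x hx => by simp [hSg x hx]
  have sumv : ∀ (f : (Fin d → ℤ) → ℝ) (S : Finset (Fin d → ℤ)), (∀ x ∉ S, f x = 0) →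
      ∀ (φ : (Fin d → ℤ) → ℝ), Summable fun x => φ x * f x := by
    intro f S hf φ
    exact summable_of_ne_finset_zero (s := S) fun x hx => by simp [hf x hx]
  -- block masses are non-negative
  have hAL0 : 0 ≤ ∑' w, L w := tsum_nonneg fun w => hL0 w
  have hAR0 : 0 ≤ ∑' c, R c := tsum_nonneg fun c => hR0 c
  have hA0 : ∀ q : Fin d → ℤ, 0 ≤ ∑' b, g (b + q) * g b := fun q => tsum_nonneg fun b => mul_nonneg (hg0 _) (hg0 _)
  -- block drifts (layer A)
  have hMQ : ∀ (e : Fin d → ℤ) (i : Fin d), ∑' b, (b i : ℝ) * (g (b + (s - e)) * g b)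
      = -(((s i : ℝ) - (e i : ℝ)) / 2) * ∑' b, g (b + (s - e)) * g b := by
    intro e i
    have h := tsum_coord_mul_shift_eq g hge (s - e) i (sumv _ Sg (hQs e) _) (summable_of_ne_finset_zero (hQs e))
    have e1 : (((s - e) i : ℤ) : ℝ) = (s i : ℝ) - (e i : ℝ) := by simp [Pi.sub_apply]
    rw [e1] at h
    exact h
  -- per-e expansions of the two integrands
  have hT : ∀ e : Fin d → ℤ,
      ∑' w, ∑' b, ∑' c, (∑ i, ((w i : ℝ) + (b i : ℝ) + (c i : ℝ)) ^ 2)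
        * ((L w) * (g (b + (s - e)) * g b) * (R c))
      = ∑ i, ((∑' w, (w i : ℝ) ^ 2 * (L w)) * (∑' b, g (b + (s - e)) * g b)
            * (∑' c, R c)
          + (∑' w, L w) * (∑' b, (b i : ℝ) ^ 2 * (g (b + (s - e)) * g b))
            * (∑' c, R c)
          + (∑' w, L w) * (∑' b, g (b + (s - e)) * g b)
            * (∑' c, (c i : ℝ) ^ 2 * (R c))
          + 2 * ((-((r₀ i : ℝ) / 2) * ∑' w, L w)
                  * (-(((s i : ℝ) - (e i : ℝ)) / 2) * ∑' b, g (b + (s - e)) * g b)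
                  * (∑' c, R c)
                + (-((r₀ i : ℝ) / 2) * ∑' w, L w) * (∑' b, g (b + (s - e)) * g b)
                  * ((((r₀ i : ℝ) + (s i : ℝ)) / 2) * ∑' c, R c)
                + (∑' w, L w) * (-(((s i : ℝ) - (e i : ℝ)) / 2) * ∑' b, g (b + (s - e)) * g b)
                  * ((((r₀ i : ℝ) + (s i : ℝ)) / 2) * ∑' c, R c))) := by
    intro e
    have h1 := tsum3_finset_sum Finset.univ L (fun b => g (b + (s - e)) * g b)
      R hLs (hQs e) hRs
      (fun (i : Fin d) (w b c : Fin d → ℤ) => ((w i : ℝ) + (b i : ℝ) + (c i : ℝ)) ^ 2)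
    beta_reduce at h1
    rw [h1]
    refine Finset.sum_congr rfl fun i _ => ?_
    have h2 := tsum3_sq_expand L (fun b => g (b + (s - e)) * g b)
      R hLs (hQs e) hRs (fun w => (w i : ℝ)) (fun b => (b i : ℝ)) (fun c => (c i : ℝ))
    beta_reduce at h2
    rw [h2, hML i, hMR i, hMQ e i]
  have hD : ∀ e : Fin d → ℤ,
      ∑' w, ∑' b, ∑' c, (∑ i, ((w i : ℝ)) ^ 2 + ∑ i, ((b i : ℝ)) ^ 2 + ∑ i, ((c i : ℝ)) ^ 2)
        * ((L w) * (g (b + (s - e)) * g b) * (R c))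
      = ∑ i, ((∑' w, (w i : ℝ) ^ 2 * (L w)) * (∑' b, g (b + (s - e)) * g b)
            * (∑' c, R c)
          + (∑' w, L w) * (∑' b, (b i : ℝ) ^ 2 * (g (b + (s - e)) * g b))
            * (∑' c, R c)
          + (∑' w, L w) * (∑' b, g (b + (s - e)) * g b)
            * (∑' c, (c i : ℝ) ^ 2 * (R c))) := by
    intro e
    have hsm : ∀ w b c : Fin d → ℤ, (∑ i, ((w i : ℝ)) ^ 2 + ∑ i, ((b i : ℝ)) ^ 2 + ∑ i, ((c i : ℝ)) ^ 2)
        = ∑ i, (((w i : ℝ)) ^ 2 + ((b i : ℝ)) ^ 2 + ((c i : ℝ)) ^ 2) := by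
      intro w b c; rw [← Finset.sum_add_distrib, ← Finset.sum_add_distrib]
    simp_rw [hsm]
    have h1 := tsum3_finset_sum Finset.univ L (fun b => g (b + (s - e)) * g b)
      R hLs (hQs e) hRs
      (fun (i : Fin d) (w b c : Fin d → ℤ) => ((w i : ℝ)) ^ 2 + ((b i : ℝ)) ^ 2 + ((c i : ℝ)) ^ 2)
    beta_reduce at h1
    rw [h1]
    refine Finset.sum_congr rfl fun i _ => ?_
    have h2 := tsum3_diag_expand L (fun b => g (b + (s - e)) * g b)
      R hLs (hQs e) hRs (fun w => (w i : ℝ)) (fun b => (b i : ℝ)) (fun c => (c i : ℝ))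
    beta_reduce at h2
    rw [h2]
  -- the difference, e by e
  have hdiff : ∀ e : Fin d → ℤ,
      ∑' w, ∑' b, ∑' c, (∑ i, ((w i : ℝ) + (b i : ℝ) + (c i : ℝ)) ^ 2)
        * ((L w) * (g (b + (s - e)) * g b) * (R c))
      = ∑' w, ∑' b, ∑' c, (∑ i, ((w i : ℝ)) ^ 2 + ∑ i, ((b i : ℝ)) ^ 2 + ∑ i, ((c i : ℝ)) ^ 2)
          * ((L w) * (g (b + (s - e)) * g b) * (R c))
        + ((∑' w, L w) * (∑' c, R c) / 2)
          * ((∑' b, g (b + (s - e)) * g b)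
            * ((-(∑ i, ((r₀ i : ℝ)) ^ 2) - ∑ i, ((s i : ℝ)) ^ 2 - ∑ i, (r₀ i : ℝ) * (s i : ℝ))
              + ∑ i, (s i : ℝ) * (e i : ℝ))) := by
    intro e
    rw [hT e, hD e]
    have hi : (-(∑ i, ((r₀ i : ℝ)) ^ 2) - ∑ i, ((s i : ℝ)) ^ 2 - ∑ i, (r₀ i : ℝ) * (s i : ℝ))
          + ∑ i, (s i : ℝ) * (e i : ℝ)
        = ∑ i, (-((r₀ i : ℝ)) ^ 2 - ((s i : ℝ)) ^ 2 - (r₀ i : ℝ) * (s i : ℝ) + (s i : ℝ) * (e i : ℝ)) := by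
      simp only [Finset.sum_add_distrib, Finset.sum_sub_distrib, Finset.sum_neg_distrib]
    rw [hi, Finset.mul_sum, Finset.mul_sum, ← Finset.sum_add_distrib]
    refine Finset.sum_congr rfl fun i _ => ?_
    ring
  -- sum over the bond `e` with weights `κ` and collect the cross term
  have key : ∑ e ∈ E, κ e * ∑' w, ∑' b, ∑' c, (∑ i, ((w i : ℝ) + (b i : ℝ) + (c i : ℝ)) ^ 2)
        * ((L w) * (g (b + (s - e)) * g b) * (R c))
      = ∑ e ∈ E, κ e * ∑' w, ∑' b, ∑' c, (∑ i, ((w i : ℝ)) ^ 2 + ∑ i, ((b i : ℝ)) ^ 2 + ∑ i, ((c i : ℝ)) ^ 2)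
          * ((L w) * (g (b + (s - e)) * g b) * (R c))
        + ((∑' w, L w) * (∑' c, R c) / 2)
          * ((∑ e ∈ E, κ e * ∑' b, g (b + (s - e)) * g b)
              * ((-(∑ i, ((r₀ i : ℝ)) ^ 2) - ∑ i, ((s i : ℝ)) ^ 2 - ∑ i, (r₀ i : ℝ) * (s i : ℝ)))
            + ∑ i, (s i : ℝ) * (∑ e ∈ E, κ e * (∑' b, g (b + (s - e)) * g b) * (e i : ℝ))) := by
    simp_rw [hdiff, mul_add, Finset.sum_add_distrib]
    congr 1
    have hN : ∑ i, (s i : ℝ) * (∑ e ∈ E, κ e * (∑' b, g (b + (s - e)) * g b) * (e i : ℝ))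
        = ∑ e ∈ E, κ e * (∑' b, g (b + (s - e)) * g b) * ∑ i, (s i : ℝ) * (e i : ℝ) := by
      simp_rw [Finset.mul_sum]
      rw [Finset.sum_comm]
      exact Finset.sum_congr rfl fun e _ => Finset.sum_congr rfl fun i _ => by ring
    rw [hN, Finset.sum_mul, Finset.mul_sum, Finset.mul_sum, ← Finset.sum_add_distrib, ← Finset.sum_add_distrib]
    exact Finset.sum_congr rfl fun e _ => by ring
  -- the sign lemma (layer B1) and the conclusion
  have hcross := cross_sign_le_zero E hE κ (fun q => ∑' b, g (b + q) * g b) hκ hA0 r₀ s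
  beta_reduce at hcross
  have hfac : 0 ≤ (∑' w, L w) * (∑' c, R c) / 2 := by positivity
  rw [key]
  nlinarith [mul_nonpos_iff.mpr (Or.inl ⟨hfac, hcross⟩)]


end Summit.CriticalPhenomena.LaceExpansionHighD.WeightSplit

end
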